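import Mathlib.Combinatorics.Hall.Basic
import Mathlib.Logic.Relation
import Summits.ValiantsHypothesis.ValiantsHypothesis.Theorems.KPlusLogSqLawTropicalBMarkedEdgeCoreQTrunk

/-!
# Route «KPlusLogSqLaw», crux `TropicalB` (stmt-ValiantsHypothesis-19771) — MARKED-EDGE sector, NESTED-TRIANGLE CORE, ALL sizes:
# the Q-COVER THEOREM (g18's «S3*»), part B1 — separation from Z-rigidity (Hall) and gate-avoiding reachability

HONEST FRAMING.  Helper file (cell `pub-symmetroid`, seat val-sym-trop-p4 (g19), 2026-08-29; `--supports stmt-ValiantsHypothesis-19771 --as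
helper`).  Continues part A (`…MarkedEdgeCoreQTrunk`).  ONE pair of «colours» `ξ, η : Equiv.Perm V` (in the application `σZ⁻¹σX, σZ⁻¹σY`), two
gates `b0 ≠ b4`, a marked arc `b ↦ z` (`ξ b = η b = z`; `b, z ∉ {b0, b4}`), and Z-RIGIDITY in cover form: every permutation `ρ` with
`ρ i ∈ {i, ξ i, η i}` for all `i` («cover inside `ξ ∪ η ∪ id`») fixing both gates is the identity.  Nothing here proves the law; nothing concerns
`TropicalB` in its window, `WeakLifting`, the doors, `MatrixDescartes` (stmt-ValiantsHypothesis-18050) or VP ≠ VNP.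

CONTENTS.
* `sep_of_rigid` — SEPARATION: Z-rigidity ⇒ a finset `C ⊆ V ∖ {b0, b4}` with `z ∈ C`, `b ∉ C`, closed under `ξ, η` up to the gates
  (Hall's marriage theorem applied to the demand «use the arc `b ↦ z`, fix both gates»: a system of distinct representatives would be a
  nontrivial gate-fixing cover; the Hall violator is the separating set).  No paths, no cycle extraction.
* `trans_ne_gates`, `reach_ne_gates`, `reach_mem_of_predClosed` — reachability by `ξ,η`-steps avoiding the gates (`Relation.TransGen` /
  `ReflTransGen` of the step relation): targets avoid the gates; a pred-closed set cannot be entered from outside.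
The pair trichotomy «Q-cover ∨ A1-witness ∨ A2-witness» built on these is part B2 (`…MarkedEdgeCoreQWitness`).
-/

set_option linter.dupNamespace false
set_option autoImplicit false

namespace Summit.ValiantsHypothesis.ValiantsHypothesis.Theorems.KPlusLogSqLaw
namespace MarkedEdge
namespace Core
namespace QCover

open Finset

variable {V : Type*} [Fintype V] [DecidableEq V]

/-! ### Separation from Z-rigidity (Hall) -/

/-- **Separation.**  If every cover inside `ξ ∪ η ∪ id` fixing `b0, b4` is trivial, then for the marked arc `b ↦ z = ξ b` there is a finset
`C ∌ b, b0, b4` containing `z` and closed under `ξ, η` up to the gates.  (Hall violator of the demand system `b ↦ {z}`, `b0 ↦ {b0}`,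
`b4 ↦ {b4}`, `i ↦ {i, ξ i, η i}`.) [this seat's lemma] -/
theorem sep_of_rigid (ξ η : Equiv.Perm V) (b0 b4 b z : V) (hξb : ξ b = z) (hbz : b ≠ z) (hbb0 : b ≠ b0) (hbb4 : b ≠ b4)
    (hz0 : z ≠ b0) (hz4 : z ≠ b4) (h04 : b0 ≠ b4)
    (H2 : ∀ ρ : Equiv.Perm V, (∀ i, ρ i = i ∨ ρ i = ξ i ∨ ρ i = η i) → ρ b0 = b0 → ρ b4 = b4 → ρ = 1) :
    ∃ C : Finset V, z ∈ C ∧ b ∉ C ∧ b0 ∉ C ∧ b4 ∉ C ∧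
      ∀ v ∈ C, (ξ v ∈ C ∨ ξ v = b0 ∨ ξ v = b4) ∧ (η v ∈ C ∨ η v = b0 ∨ η v = b4) := by
  classical
  let t : V → Finset V := fun i =>
    if i = b then {z} else if i = b0 then {b0} else if i = b4 then {b4} else {i, ξ i, η i}
  have htb : t b = {z} := by simp [t]
  have ht0 : t b0 = {b0} := by simp [t, hbb0.symm]
  have ht4 : t b4 = {b4} := by simp [t, hbb4.symm, h04.symm]
  have htg : ∀ i, i ≠ b → i ≠ b0 → i ≠ b4 → t i = {i, ξ i, η i} := fun i h1 h2 h3 => by simp [t, h1, h2, h3]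
  -- Hall's condition fails
  have hnot : ¬ ∀ S : Finset V, S.card ≤ (S.biUnion t).card := by
    intro hall
    obtain ⟨f, hf, hft⟩ := (Finset.all_card_le_biUnion_card_iff_exists_injective t).mp hall
    have hbij : Function.Bijective f := Finite.injective_iff_bijective.mp hf
    let ρ : Equiv.Perm V := Equiv.ofBijective f hbij
    have hρ : ∀ i, ρ i = f i := fun i => rfl
    have hρb : ρ b = z := by have := hft b; rw [htb, Finset.mem_singleton] at this; rw [hρ, this]
    have hρ0 : ρ b0 = b0 := by have := hft b0; rw [ht0, Finset.mem_singleton] at this; rw [hρ, this]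
    have hρ4 : ρ b4 = b4 := by have := hft b4; rw [ht4, Finset.mem_singleton] at this; rw [hρ, this]
    have hcov : ∀ i, ρ i = i ∨ ρ i = ξ i ∨ ρ i = η i := by
      intro i
      by_cases h1 : i = b
      · subst h1; right; left; rw [hρb, hξb]
      by_cases h2 : i = b0
      · subst h2; left; exact hρ0
      by_cases h3 : i = b4
      · subst h3; left; exact hρ4
      have := hft i
      rw [htg i h1 h2 h3] at this
      simpa [hρ] using this
    have h1 := H2 ρ hcov hρ0 hρ4
    apply hbz
    rw [← hρb, h1, Equiv.Perm.one_apply]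
  push Not at hnot
  obtain ⟨S, hS⟩ := hnot
  set U := S.biUnion t with hU
  have hsub : S.erase b ⊆ U := by
    intro i hi
    rw [Finset.mem_erase] at hi
    rw [hU, Finset.mem_biUnion]
    refine ⟨i, hi.2, ?_⟩
    by_cases h2 : i = b0
    · subst h2; rw [ht0]; simp
    by_cases h3 : i = b4
    · subst h3; rw [ht4]; simp
    rw [htg i hi.1 h2 h3]; simp
  have hbS : b ∈ S := by
    by_contra h
    rw [Finset.erase_eq_of_notMem h] at hsub
    exact absurd (Finset.card_le_card hsub) (by omega)
  have hce := Finset.card_erase_of_mem hbS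
  have hUe : U = S.erase b := (Finset.eq_of_subset_of_card_le hsub (by omega)).symm
  have hzU : z ∈ U := by
    rw [hU, Finset.mem_biUnion]
    exact ⟨b, hbS, by rw [htb]; simp⟩
  refine ⟨((S.erase b).erase b0).erase b4, ?_, ?_, ?_, ?_, ?_⟩
  · have hz' := hzU
    rw [hUe, Finset.mem_erase] at hz'
    simp only [Finset.mem_erase]
    exact ⟨hz4, hz0, hz'⟩
  · simp
  · simp
  · simp
  · intro v hv
    simp only [Finset.mem_erase] at hv
    obtain ⟨hv4, hv0, hvb, hvS⟩ := hv
    have htv : t v ⊆ U := by rw [hU]; exact Finset.subset_biUnion_of_mem t hvS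
    rw [htg v hvb hv0 hv4, hUe] at htv
    have hξv : ξ v ∈ S.erase b := htv (by simp)
    have hηv : η v ∈ S.erase b := htv (by simp)
    constructor
    · by_cases h0 : ξ v = b0
      · exact Or.inr (Or.inl h0)
      by_cases h4 : ξ v = b4
      · exact Or.inr (Or.inr h4)
      left; simp only [Finset.mem_erase]; exact ⟨h4, h0, Finset.mem_erase.mp hξv⟩
    · by_cases h0 : η v = b0
      · exact Or.inr (Or.inl h0)
      by_cases h4 : η v = b4
      · exact Or.inr (Or.inr h4)
      left; simp only [Finset.mem_erase]; exact ⟨h4, h0, Finset.mem_erase.mp hηv⟩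

/-! ### Reachability inside `W = V ∖ {b0, b4}` -/

omit [Fintype V] [DecidableEq V] in
/-- Targets of steps avoid the gates: everything reachable in `≥ 1` steps avoids the gates. [folklore] -/
theorem trans_ne_gates (ξ η : Equiv.Perm V) (b0 b4 : V) (r : V → V → Prop)
    (hr : ∀ u v, r u v ↔ (v = ξ u ∨ v = η u) ∧ v ≠ b0 ∧ v ≠ b4) (a v : V)
    (h : Relation.TransGen r a v) : v ≠ b0 ∧ v ≠ b4 := by
  induction h with
  | single h => exact ((hr _ _).mp h).2
  | tail _ hwv _ => exact ((hr _ _).mp hwv).2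

omit [Fintype V] [DecidableEq V] in
/-- Everything reachable (in `≥ 0` steps) from a non-gate avoids the gates. [folklore] -/
theorem reach_ne_gates (ξ η : Equiv.Perm V) (b0 b4 : V) (r : V → V → Prop)
    (hr : ∀ u v, r u v ↔ (v = ξ u ∨ v = η u) ∧ v ≠ b0 ∧ v ≠ b4) (a v : V) (ha0 : a ≠ b0) (ha4 : a ≠ b4)
    (h : Relation.ReflTransGen r a v) : v ≠ b0 ∧ v ≠ b4 := by
  induction h with
  | refl => exact ⟨ha0, ha4⟩
  | tail _ hwv _ => exact ((hr _ _).mp hwv).2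

omit [Fintype V] [DecidableEq V] in
/-- **No entry into a pred-closed set from outside.**  If `C` is closed under `ξ⁻¹, η⁻¹` up to the gates and a point `v ∈ C` is reachable
from a non-gate `a`, then `a ∈ C`. [folklore] -/
theorem reach_mem_of_predClosed (ξ η : Equiv.Perm V) (b0 b4 : V) (r : V → V → Prop)
    (hr : ∀ u v, r u v ↔ (v = ξ u ∨ v = η u) ∧ v ≠ b0 ∧ v ≠ b4) (C : Finset V)
    (hC : ∀ v ∈ C, (ξ⁻¹ v ∈ C ∨ ξ⁻¹ v = b0 ∨ ξ⁻¹ v = b4) ∧ (η⁻¹ v ∈ C ∨ η⁻¹ v = b0 ∨ η⁻¹ v = b4))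
    (a v : V) (ha0 : a ≠ b0) (ha4 : a ≠ b4) (h : Relation.ReflTransGen r a v) (hv : v ∈ C) : a ∈ C := by
  induction h with
  | refl => exact hv
  | tail hzw hwv ih =>
    rename_i w v'
    apply ih
    have hw := reach_ne_gates ξ η b0 b4 r hr a w ha0 ha4 hzw
    obtain ⟨hv'w, -, -⟩ := (hr _ _).mp hwv
    rcases hv'w with h | h
    · have e : ξ⁻¹ v' = w := by rw [Equiv.Perm.inv_eq_iff_eq, h]
      rcases (hC v' hv).1 with h1 | h1 | h1
      · rw [← e]; exact h1
      · exact absurd (e.symm.trans h1) hw.1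
      · exact absurd (e.symm.trans h1) hw.2
    · have e : η⁻¹ v' = w := by rw [Equiv.Perm.inv_eq_iff_eq, h]
      rcases (hC v' hv).2 with h1 | h1 | h1
      · rw [← e]; exact h1
      · exact absurd (e.symm.trans h1) hw.1
      · exact absurd (e.symm.trans h1) hw.2

end QCover
end Core
end MarkedEdge
end Summit.ValiantsHypothesis.ValiantsHypothesis.Theorems.KPlusLogSqLaw
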